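import Literature.NumberTheory.Rogawski1990.LocalStableClassesNonsplitTypeOneOfCharpoly   -- ★ B-p04: `exists_eigenframe_of_charpoly_eq_prod` (generic field, any `m`)
import Literature.NumberTheory.Automorphic.UnitaryGroupNonsplitPlace                      -- ★ `LocalRing.isField_of_smul_eq`, `PlacesOver.subsingleton_of_smul_eq`
import HarnessLib

/-!
# An eigenframe of a `2 × 2` element from ONE root of a separable characteristic polynomial, over a field and over `E_v = L ⊗ L⁺_v` at a non-split place
(Rogawski 1990, §3.5 p. 29, §3.6 p. 31 — the split torus `(E¹)²`; Flicker 1998, §6 p. 95)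

Topic `NumberTheory/Automorphic`; namespace `Literature.NumberTheory.Automorphic.UnitaryGroup`.  THEOREMS ONLY (no definition, no instance, no notation, no named fact,
no `sorry`; count-neutral).  Cell `pub/hodgecm-mathlib`, F0∕P3a road «D-N7-inert», line «N7nsCount» (`stub_countSplitClause`), brick **(E1) «EIGENFRAME FROM `hsplit`»** of
B-p10 (g24)'s (S1-bis) «H-value in the stub frame» (2026-09-01T04:23:15Z census; architect A-p06 (g26)).  HONEST LABEL: HC_CM is proved only modulo the printed citations
until rung 0 closes; elementary linear algebra here.

THE MATHEMATICS.  (§1, any field `K`) A monic quadratic `p` with a root `α` factors as `(X − α)(X − α′)`, `α′` the other root; if `p` is separable then `α ≠ α′`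
(`roots p` has no duplicates, Mathlib `nodup_roots`); hence a `g ∈ GL₂(K)` whose SEPARABLE characteristic polynomial has a root `α ∈ K` has an EIGENFRAME
`g P = P · diag(u)` with `u = (α, α′)` injective (★ B-p04 `exists_eigenframe_of_charpoly_eq_prod`).  (§2) At a NON-SPLIT place `v` of `L⁺` in the CM field `L` the ring
`E_v = Π_{w∣v} L_w` IS the field `L_w` (one factor; ★ `LocalRing.isField_of_smul_eq`, Mathlib `RingEquiv.piUnique`), so a root `α ∈ L_w` of the `w`-component
`χ_w = χ.map eval_w` of the characteristic polynomial of `γ ∈ GL₂(E_v)` lifts to a root of `χ` in `E_v` and §1 applies: **`exists_eigenframe_of_isRoot_map_of_separable`** —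
the `hsplit : ∃ x, χ_{g,w}.IsRoot x` of `stub_countSplitClause` produces the eigenframe `(P, u)` that ★ `LocalStableClassesNonsplitRankTwo` ∕ ★ (L5) ∕ ★ (L5-d1) consume,
with `u₀` read back as `α` at `w`.

## References
* [Rogawski1990] J. D. Rogawski, *Automorphic Representations of Unitary Groups in Three Variables*, Ann. of Math. Stud. 123 (1990), §3.5 p. 29, §3.6 p. 31.
* [Flicker1998UnitaryFL] Y. Z. Flicker, *Elementary proof of the fundamental lemma for a unitary group*, Canad. J. Math. 50 (1998), §6 p. 95.
* [HornJohnson2013] R. A. Horn, C. R. Johnson, *Matrix Analysis*, 2nd ed. (2013), Thm. 1.3.9 (distinct eigenvalues ⇒ diagonalisable).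
-/

set_option autoImplicit false

noncomputable section

open Matrix Polynomial NumberField IsDedekindDomain
open scoped MatrixGroups

namespace Literature.NumberTheory.Automorphic.UnitaryGroup

open Literature.NumberTheory.Rogawski1990

/-! ## §1 Over a field: the second root, distinctness from separability, the eigenframe -/

section Field

variable {K : Type*} [Field K]

/-- **A monic quadratic with a root `α` is `(X − α)(X − α′)`**, `α′` its other root. [cite: HornJohnson2013, Thm. 1.3.9] -/
theorem exists_eq_X_sub_C_mul_X_sub_C_of_isRoot {p : K[X]} (hp : p.Monic) (hdeg : p.natDegree = 2) {α : K} (hα : p.IsRoot α) :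
    ∃ α' : K, p = (X - C α) * (X - C α') := by
  set q : K[X] := p /ₘ (X - C α) with hq
  have hpq : (X - C α) * q = p := (Polynomial.mul_divByMonic_eq_iff_isRoot).2 hα
  have hqdeg : q.natDegree = 1 := by
    rw [hq, Polynomial.natDegree_divByMonic p (Polynomial.monic_X_sub_C α), hdeg, Polynomial.natDegree_X_sub_C]
  have hqlc : q.leadingCoeff = 1 := by
    have h := congrArg Polynomial.leadingCoeff hpq
    rw [Polynomial.leadingCoeff_mul, Polynomial.leadingCoeff_X_sub_C, one_mul] at h
    rw [h]; exact hp
  refine ⟨-q.coeff 0, ?_⟩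
  have hqe : q = X - C (-q.coeff 0) := by
    rw [map_neg, sub_neg_eq_add]
    ext n
    rcases n with _ | _ | n
    · simp
    · have : q.coeff 1 = 1 := by rw [← hqdeg]; exact hqlc
      simp [this]
    · have hz : q.coeff (n + 2) = 0 := Polynomial.coeff_eq_zero_of_natDegree_lt (by rw [hqdeg]; omega)
      rw [hz]; simp [Polynomial.coeff_X]
  rw [← hpq, ← hqe]

/-- **… and the two roots are DISTINCT when `p` is separable** (`roots ((X − α)(X − α′)) = {α, α′}` has no duplicates, Mathlib `nodup_roots`). [cite: HornJohnson2013, Thm. 1.3.9] -/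
theorem ne_of_eq_X_sub_C_mul_X_sub_C_of_separable {p : K[X]} {α α' : K} (hp : p = (X - C α) * (X - C α')) (hsep : p.Separable) : α ≠ α' := by
  intro h
  subst h
  have hnd := Polynomial.nodup_roots hsep
  rw [hp, Polynomial.roots_mul (mul_ne_zero (Polynomial.X_sub_C_ne_zero α) (Polynomial.X_sub_C_ne_zero α)), Polynomial.roots_X_sub_C,
    Multiset.singleton_add] at hnd
  exact ((Multiset.nodup_cons).1 hnd).1 (Multiset.mem_singleton_self α)

/-- **AN EIGENFRAME FROM ONE ROOT OF A SEPARABLE CHARACTERISTIC POLYNOMIAL** (`2 × 2`): `g ∈ GL₂(K)` with `charpoly g` separable and a root `α ∈ K` has `g P = P · diag(u)`,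
`u = (α, α′)` injective, `u₀ = α` (★ `exists_eigenframe_of_charpoly_eq_prod`). [cite: HornJohnson2013, Thm. 1.3.9] [cite: Rogawski1990, §3.6 p. 31] -/
theorem exists_eigenframe_of_isRoot_of_separable (g : GL (Fin 2) K) {α : K}
    (hα : ((g : Matrix (Fin 2) (Fin 2) K).charpoly).IsRoot α) (hsep : ((g : Matrix (Fin 2) (Fin 2) K).charpoly).Separable) :
    ∃ (P : GL (Fin 2) K) (u : Fin 2 → K), (g : Matrix (Fin 2) (Fin 2) K) * P.val = P.val * diagonal u ∧ Function.Injective u ∧ u 0 = α := by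
  obtain ⟨α', hfac⟩ := exists_eq_X_sub_C_mul_X_sub_C_of_isRoot (Matrix.charpoly_monic _)
    (by rw [Matrix.charpoly_natDegree_eq_dim, Fintype.card_fin]) hα
  have hne : α ≠ α' := ne_of_eq_X_sub_C_mul_X_sub_C_of_separable hfac hsep
  have hu : Function.Injective (![α, α'] : Fin 2 → K) := by
    intro i j hij
    fin_cases i <;> fin_cases j
    · rfl
    · exact absurd hij hne
    · exact absurd hij.symm hne
    · rfl
  have hprod : (g : Matrix (Fin 2) (Fin 2) K).charpoly = ∏ i, (X - C ((![α, α'] : Fin 2 → K) i)) := by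
    rw [Fin.prod_univ_two]
    exact hfac
  obtain ⟨P, hP⟩ := exists_eigenframe_of_charpoly_eq_prod g ![α, α'] hu hprod
  exact ⟨P, ![α, α'], hP, hu, rfl⟩

end Field

/-! ## §2 Over `E_v = L ⊗ L⁺_v` at a non-split place: lifting a root of the `w`-component -/

section Nonsplit

variable (L : Type) [Field L] [NumberField L] [IsCMField L] (v : HeightOneSpectrum (𝓞 ↥(maximalRealSubfield L)))
  (w : PlacesOver L v) (hw : IsCMField.complexConj L • w.1 = w.1)

include hw in
/-- **(E1) EIGENFRAME FROM `hsplit` AT A NON-SPLIT PLACE.**  For `γ ∈ GL₂(E_v)` (`E_v = Π_{w∣v} L_w`, e.g. the matrix of `γ₂ ∈ (cmDatum L 2 Φ₂).Local v`) with SEPARABLE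
characteristic polynomial `χ` and a root `α ∈ L_w` of its `w`-component `χ.map eval_w` (the stub's `hsplit`), there is an eigenframe `γ P = P · diag(u)` over `E_v` with `u`
injective and `u₀` READ BACK AS `α` at `w` (`E_v = L_w` is a field at a non-split `v`, so `α` lifts to a root of `χ`; then §1).
[cite: Rogawski1990, §3.6 p. 31; §3.5 p. 29] [cite: Flicker1998UnitaryFL, §6 p. 95] -/
theorem exists_eigenframe_of_isRoot_map_of_separable (γ : GL (Fin 2) (LocalRing L v)) {α : w.1.adicCompletion L}
    (hα : (((γ : Matrix (Fin 2) (Fin 2) (LocalRing L v)).charpoly).map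
      (Pi.evalRingHom (fun w' : PlacesOver L v => w'.1.adicCompletion L) w)).IsRoot α)
    (hsep : ((γ : Matrix (Fin 2) (Fin 2) (LocalRing L v)).charpoly).Separable) :
    ∃ (P : GL (Fin 2) (LocalRing L v)) (u : Fin 2 → LocalRing L v),
      (γ : Matrix (Fin 2) (Fin 2) (LocalRing L v)) * P.val = P.val * diagonal u ∧ Function.Injective u ∧ u 0 w = α := by
  have hc1 : IsCMField.complexConj L ≠ 1 := IsCMField.complexConj_ne_one L
  haveI : Subsingleton (PlacesOver L v) := PlacesOver.subsingleton_of_smul_eq (IsCMField.complexConj L) hc1 w hw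
  letI : Field (LocalRing L v) := (LocalRing.isField_of_smul_eq (IsCMField.complexConj L) hc1 w hw).toField
  letI : Unique (PlacesOver L v) := uniqueOfSubsingleton w
  let π : LocalRing L v ≃+* w.1.adicCompletion L := RingEquiv.piUnique fun w' : PlacesOver L v => w'.1.adicCompletion L
  have hπ : (π : LocalRing L v →+* w.1.adicCompletion L) = Pi.evalRingHom (fun w' : PlacesOver L v => w'.1.adicCompletion L) w := rfl
  -- lift the root: `χ = (χ.map π).map π.symm` has the root `π.symm α`
  have hroot : ((γ : Matrix (Fin 2) (Fin 2) (LocalRing L v)).charpoly).IsRoot (π.symm α) := by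
    have h := hα.map (f := (π.symm : w.1.adicCompletion L →+* LocalRing L v))
    rw [← hπ, Polynomial.map_map] at h
    have hcomp : (π.symm : w.1.adicCompletion L →+* LocalRing L v).comp (π : LocalRing L v →+* w.1.adicCompletion L) = RingHom.id _ :=
      RingHom.ext fun x => π.symm_apply_apply x
    rw [hcomp, Polynomial.map_id] at h
    exact h
  obtain ⟨P, u, hP, hu, hu0⟩ := exists_eigenframe_of_isRoot_of_separable γ hroot hsep
  refine ⟨P, u, hP, hu, ?_⟩
  rw [hu0]
  exact π.apply_symm_apply α

include hw in
/-- The same on the CM carrier `(cmDatum L 2 J).Local v` (any `J`): an eigenframe of `γ₂` over `E_v` from a root of `χ_{γ₂,w}` and separability of `χ_{γ₂}` — the input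
shape of ★ `LocalStableClassesNonsplitRankTwo` ∕ ★ `UnitStableOrbitalIntegralHSideValue` (`hP : γ₂.val.val * P.val = P.val * diagonal u`, `hu : Injective u`).
[cite: Rogawski1990, §3.6 p. 31] [cite: Flicker1998UnitaryFL, §6 p. 95] -/
theorem exists_eigenframe_cmDatum_local_of_isRoot_map_of_separable {J : Matrix (Fin 2) (Fin 2) L} (γ₂ : (cmDatum L 2 J).Local v)
    {α : w.1.adicCompletion L}
    (hα : (((γ₂.val : GL (Fin 2) (LocalRing L v)) : Matrix (Fin 2) (Fin 2) (LocalRing L v)).charpoly.map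
      (Pi.evalRingHom (fun w' : PlacesOver L v => w'.1.adicCompletion L) w)).IsRoot α)
    (hsep : (((γ₂.val : GL (Fin 2) (LocalRing L v)) : Matrix (Fin 2) (Fin 2) (LocalRing L v)).charpoly).Separable) :
    ∃ (P : GL (Fin 2) (LocalRing L v)) (u : Fin 2 → LocalRing L v),
      ((γ₂.val : GL (Fin 2) (LocalRing L v)) : Matrix (Fin 2) (Fin 2) (LocalRing L v)) * P.val = P.val * diagonal u ∧ Function.Injective u ∧ u 0 w = α :=
  exists_eigenframe_of_isRoot_map_of_separable L v w hw γ₂.val hα hsep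

end Nonsplit

end Literature.NumberTheory.Automorphic.UnitaryGroup

end
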